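import Literature.AlgebraicGeometry.HodgeTheory.WeilClassesDescendingOfLefschetzOneOne
import HarnessLib

/-!
# The exterior ("virtual") pull-back `⋀•L : H•(X; R) → H•(Y; R)` of a linear map `L : H¹(X; R) → H¹(Y; R)`

Family `hodge`, layer `Literature/AlgebraicGeometry/HodgeTheory` (next to the other general cup-power lemmas of the layer,
`cupPowOne_eq_cupProduct_split` / `cupProduct_cupPowOne_cupPowOne` / `cupPowOne_basis_ne_zero` of
`WeilClassesDescendingOfLefschetzOneOne`, which it uses; the content is general algebraic topology). A formal consequence of the predicate
`HasExteriorCohomologyH1 R X` ("`H•(X; R) = ⋀• H¹(X; R)`", file `CupProductExteriorH1`): when every comparison map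
`⋀ᵈ H¹(X; R) → Hᵈ(X; R)` is bijective, ANY `R`-linear map `L : H¹(X; R) → H¹(Y; R)` (to the first cohomology of
ANY space `Y`) extends uniquely to a family of `R`-linear maps

  `exteriorPullback hX L d : Hᵈ(X; R) → Hᵈ(Y; R)`,  `v₀ ⌣ ⋯ ⌣ v_{d-1} ↦ L v₀ ⌣ ⋯ ⌣ L v_{d-1}`,

namely `wedgeToCup_Y ∘ ⋀ᵈ L ∘ (wedgeToCup_X)⁻¹`; it is multiplicative for the cup product
(`exteriorPullback_cupProduct`), it is the honest pull-back `f^*` when `L = f^*|_{H¹}` for a continuous `f : Y → X`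
(`exteriorPullback_map`, Hatcher Prop. 3.10), and it is injective in every degree as soon as `L` is injective, `R`
is a field and `Y` too has exterior cohomology (`exteriorPullback_injective`, Mathlib `exteriorPower.map_injective_field`).

WHY (the use made of it in `Literature/AlgebraicGeometry/HodgeTheory/WeilClassesSquareDivisorPolynomial` and its sequels
`…Squares`, `WeilClassesSquareRationalBasis`, `AbelianVarietyPullbackQuadratic`, `WeilClassesSquareKSymmetric`): for a
complex abelian variety `A` the ring `End(A) ⊗ ℂ` acts on `H•(A(ℂ); ℂ) = ⋀• H¹` through its action on `H¹`
(van Geemen, LNM 1594, 4.8: "using the maps `f^*` … the algebra `End(X)_ℚ` acts"; Deligne, LNM 900, (4.3)–(4.4));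
an element such as `p₁ + i√d·p₂ ∈ Hom(T × T, T) ⊗ ℂ` is not a morphism, but its action `⋀•(p₁^* + i√d·p₂^*)` is
`exteriorPullback`, and it carries the top class of `T` to a generator of a Weil line of `T × T`. Nothing here is
specific to abelian varieties: only the exterior-algebra predicate on the SOURCE is used.

## Main results (all proved; no named fact)

* `exteriorPullback_cupPowOne`: `⋀ᵈL (v₀ ⌣ ⋯ ⌣ v_{d-1}) = L v₀ ⌣ ⋯ ⌣ L v_{d-1}`.
* `exteriorPullback_one`, `exteriorPullback_cupProduct`: `⋀•L` is a homomorphism of graded rings.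
* `exteriorPullback_map`: `⋀•(f^*|_{H¹}) = f^*`.
* `exteriorPullback_injective`: over a field, `L` injective and `H•(Y) = ⋀•H¹(Y)` ⟹ `⋀ᵈL` injective.
* `exteriorPullback_ext`: a linear map `Hᵈ(X) → N` is determined by its values on products of degree-one classes
  (restated from `HasExteriorCohomologyH1.span_range_cupPowOne` in the form used downstream).

## References

* [Hatcher2002] A. Hatcher, *Algebraic Topology* (2002), §3.2 Prop. 3.10, Example 3.16.
* [LangeBirkenhake1992] H. Lange, Ch. Birkenhake, *Complex Abelian Varieties* (1992), Lemma 1.1.17, Exercise 1.1.6 (7).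
* [vanGeemen1994HodgeAV] B. van Geemen, LNM 1594 (1994), 4.8 (the action of `End(X)_ℚ` on `H•` via `f^*`).
* [Deligne1982HodgeCycles] P. Deligne, LNM 900 (1982), §4 (4.3)–(4.4).
-/

noncomputable section

universe u v

namespace Literature.AlgebraicGeometry.HodgeTheory

open Literature.AlgebraicTopology.SingularHomology

variable {R : Type v} [CommRing R] [Invertible (2 : R)] {X Y : Type u} [TopologicalSpace X] [TopologicalSpace Y]

/-- **The exterior pull-back `⋀ᵈ L : Hᵈ(X; R) → Hᵈ(Y; R)` of a linear map `L : H¹(X; R) → H¹(Y; R)`**, for `X`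
with `H•(X; R) = ⋀• H¹(X; R)`: the composite `wedgeToCup_Y ∘ ⋀ᵈ L ∘ (wedgeToCup_X)⁻¹`. For `L = f^*|_{H¹}` it is
`f^*` (`exteriorPullback_map`); in general it is the action on `H•` of a "virtual morphism" acting by `L` on `H¹`
(van Geemen 4.8: the action of `End(X) ⊗ ℚ`, here `⊗ R`, on the exterior algebra). [cite: vanGeemen1994HodgeAV, 4.8]
[cite: Hatcher2002, §3.2 Example 3.16] -/
def exteriorPullback (hX : HasExteriorCohomologyH1 R X)
    (L : singularCohomology R R X 1 →ₗ[R] singularCohomology R R Y 1) (d : ℕ) :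
    singularCohomology R R X d →ₗ[R] singularCohomology R R Y d :=
  wedgeToCup R Y d ∘ₗ exteriorPower.map d L ∘ₗ (hX.equiv d).symm.toLinearMap

/-- The inverse comparison isomorphism sends `v₀ ⌣ ⋯ ⌣ v_{d-1}` to `v₀ ∧ ⋯ ∧ v_{d-1}`. [folklore] -/
theorem HasExteriorCohomologyH1.equiv_symm_cupPowOne (hX : HasExteriorCohomologyH1 R X) (d : ℕ) (v : Fin d → singularCohomology R R X 1) :
    (hX.equiv d).symm (cupPowOne R X d v) = exteriorPower.ιMulti R d v := by
  rw [LinearEquiv.symm_apply_eq, HasExteriorCohomologyH1.equiv_apply, wedgeToCup_ιMulti]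

/-- **`⋀ᵈL (v₀ ⌣ ⋯ ⌣ v_{d-1}) = L v₀ ⌣ ⋯ ⌣ L v_{d-1}`.** [cite: Hatcher2002, §3.2 Example 3.16] -/
theorem exteriorPullback_cupPowOne (hX : HasExteriorCohomologyH1 R X)
    (L : singularCohomology R R X 1 →ₗ[R] singularCohomology R R Y 1) (d : ℕ) (v : Fin d → singularCohomology R R X 1) :
    exteriorPullback hX L d (cupPowOne R X d v) = cupPowOne R Y d (fun i => L (v i)) := by
  simp only [exteriorPullback, LinearMap.coe_comp, Function.comp_apply, LinearEquiv.coe_toLinearMap,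
    HasExteriorCohomologyH1.equiv_symm_cupPowOne, exteriorPower.map_apply_ιMulti, wedgeToCup_ιMulti]
  rfl

/-- **A linear map out of `Hᵈ(X; R)` is determined by its values on the products `v₀ ⌣ ⋯ ⌣ v_{d-1}`** of
degree-one classes (they span `Hᵈ`, `HasExteriorCohomologyH1.span_range_cupPowOne`). [folklore] -/
theorem exteriorPullback_ext (hX : HasExteriorCohomologyH1 R X) {N : Type*} [AddCommGroup N] [Module R N] {d : ℕ}
    {f g : singularCohomology R R X d →ₗ[R] N}
    (h : ∀ v : Fin d → singularCohomology R R X 1, f (cupPowOne R X d v) = g (cupPowOne R X d v)) : f = g :=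
  LinearMap.ext_on_range (hX.span_range_cupPowOne d) h

/-- `⋀⁰L (1) = 1`. [folklore] -/
theorem exteriorPullback_one (hX : HasExteriorCohomologyH1 R X)
    (L : singularCohomology R R X 1 →ₗ[R] singularCohomology R R Y 1) : exteriorPullback hX L 0 (singularCohomology.one R X) = singularCohomology.one R Y := by
  have h := exteriorPullback_cupPowOne hX L 0 (fun i => Fin.elim0 i)
  rwa [cupPowOne_zero, cupPowOne_zero] at h

/-- **`⋀•L` is multiplicative: `⋀^{a+b}L (x ⌣ y) = ⋀ᵃL x ⌣ ⋀ᵇL y`** (both sides are bilinear and agree on products of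
degree-one classes, where the product of `v₀ ⌣ ⋯ ⌣ v_{a-1}` and `w₀ ⌣ ⋯ ⌣ w_{b-1}` is the iterated product of the
concatenated family, `cupProduct_cupPowOne_cupPowOne`). [cite: Hatcher2002, §3.2 Prop. 3.10 and Example 3.16] -/
theorem exteriorPullback_cupProduct (hX : HasExteriorCohomologyH1 R X)
    (L : singularCohomology R R X 1 →ₗ[R] singularCohomology R R Y 1) {a b c : ℕ} (h : a + b = c) (x : singularCohomology R R X a)
    (y : singularCohomology R R X b) :
    exteriorPullback hX L c (cupProduct h x y) =
      cupProduct h (exteriorPullback hX L a x) (exteriorPullback hX L b y) := by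
  subst h
  -- the two bilinear maps `(x, y) ↦ ⋀L (x ⌣ y)` and `(x, y) ↦ ⋀L x ⌣ ⋀L y`
  set B₁ : singularCohomology R R X a →ₗ[R] singularCohomology R R X b →ₗ[R] singularCohomology R R Y (a + b) :=
    (cupProduct (rfl : a + b = a + b)).compr₂ (exteriorPullback hX L (a + b)) with hB₁
  set B₂ : singularCohomology R R X a →ₗ[R] singularCohomology R R X b →ₗ[R] singularCohomology R R Y (a + b) :=
    (cupProduct (rfl : a + b = a + b)).compl₁₂ (exteriorPullback hX L a) (exteriorPullback hX L b) with hB₂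
  suffices hB : B₁ = B₂ by
    have := LinearMap.congr_fun₂ hB x y
    simpa only [hB₁, hB₂, LinearMap.compr₂_apply, LinearMap.compl₁₂_apply] using this
  refine exteriorPullback_ext hX fun v => exteriorPullback_ext hX fun w => ?_
  simp only [hB₁, hB₂, LinearMap.compr₂_apply, LinearMap.compl₁₂_apply, exteriorPullback_cupPowOne]
  rw [cupProduct_cupPowOne_cupPowOne R v w, exteriorPullback_cupPowOne, cupProduct_cupPowOne_cupPowOne R]
  congr 1
  funext i
  refine Fin.addCases (fun j => ?_) (fun j => ?_) i
  · simp only [Fin.append_left]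
  · simp only [Fin.append_right]

/-- **`⋀•(f^*|_{H¹}) = f^*`**: for a continuous `f : Y → X`, the exterior pull-back of `f^*` on `H¹` is `f^*` in
every degree (Hatcher Prop. 3.10: `f^*` is multiplicative, so both agree on products of degree-one classes).
[cite: Hatcher2002, §3.2 Prop. 3.10] -/
theorem exteriorPullback_map (hX : HasExteriorCohomologyH1 R X) (f : C(Y, X)) (d : ℕ) :
    exteriorPullback hX (singularCohomology.map R R f 1).hom d = (singularCohomology.map R R f d).hom := by
  refine exteriorPullback_ext hX fun v => ?_
  rw [exteriorPullback_cupPowOne]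
  exact (map_cupPowOne f d v).symm

/-- Element form of `exteriorPullback_map`. [cite: Hatcher2002, §3.2 Prop. 3.10] -/
theorem exteriorPullback_map_apply (hX : HasExteriorCohomologyH1 R X) (f : C(Y, X)) (d : ℕ) (x : singularCohomology R R X d) :
    exteriorPullback hX (singularCohomology.map R R f 1).hom d x = singularCohomology.map R R f d x := by
  rw [exteriorPullback_map]

/-- **`⋀ᵈL` is injective when `L` is injective**, over a field, if `Y` also has exterior cohomology (then
`wedgeToCup_Y` is bijective and `⋀ᵈ` of an injective linear map of vector spaces is injective, Mathlib
`exteriorPower.map_injective_field`). [folklore] -/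
theorem exteriorPullback_injective {K : Type v} [Field K] [Invertible (2 : K)] {X' Y' : Type u} [TopologicalSpace X']
    [TopologicalSpace Y'] (hX' : HasExteriorCohomologyH1 K X') (hY' : HasExteriorCohomologyH1 K Y')
    {L' : singularCohomology K K X' 1 →ₗ[K] singularCohomology K K Y' 1} (hL : Function.Injective L') (d : ℕ) :
    Function.Injective (exteriorPullback hX' L' d) := by
  change Function.Injective (fun x => wedgeToCup K Y' d (exteriorPower.map d L' ((hX'.equiv d).symm x)))
  exact (hY' d).1.comp ((exteriorPower.map_injective_field hL).comp (hX'.equiv d).symm.injective)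

/-- **`⋀•L` depends only on `L`**: linear maps that agree on `H¹` have the same exterior pull-back (congruence
helper for rewriting `L` into a convenient form, e.g. `(f + g)^*|_{H¹} = f^*|_{H¹} + g^*|_{H¹}` on an abelian variety).
[folklore] -/
theorem exteriorPullback_congr (hX : HasExteriorCohomologyH1 R X) {L L' : singularCohomology R R X 1 →ₗ[R] singularCohomology R R Y 1}
    (h : ∀ v, L v = L' v) (d : ℕ) : exteriorPullback hX L d = exteriorPullback hX L' d := by
  have : L = L' := LinearMap.ext h
  rw [this]

end Literature.AlgebraicGeometry.HodgeTheory

end
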